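import Mathlib

/-!
# Jacobi's complementary-minor identity for arbitrary minors (norm form)

Stub `stub_jacobiMinorNorm` of crux `stmt-QuantumFields-9151`
(`Summit.QuantumFields.QCD.Theses.PauliWegnerSea.PhaseQuenchedFlavourDecay`,
line `crossing-split-integrability`).

Jacobi's theorem on complementary minors (Horn–Johnson, *Matrix Analysis*, §0.8.4): for an
invertible square matrix `M`, a set of rows `I` and a set of columns `J` of the same size `r`, with
complements `I'` and `J'`,
`det ((M⁻¹)[I, J]) * det M = ± det (M[J', I'])`:
the rows of the complementary minor are the complement of the *columns* `J`, its columns the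
complement of the *rows* `I`.  Downstream only the absolute value matters, so the main statement is
in norm form over `ℂ`:
`‖det ((M⁻¹)[I, J])‖ * ‖det M‖ = ‖det (M[J', I'])‖`.

Proof.  The core is the block identity `Matrix.det_inv_toBlocks₁₁_mul_det`: for an invertible
block matrix `N = [[A, B], [C, D]]` with inverse `N⁻¹ = [[P, Q], [U, V]]`, reading `N⁻¹ * N = 1`
blockwise gives `P * A + Q * C = 1` and `P * B + Q * D = 0`, whence the block-triangular
factorisation `[[P, Q], [0, 1]] * N = [[1, 0], [C, D]]`; taking determinants,
`det P * det N = det D` (no invertibility of `D` is needed).  For general row/column selections,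
reindex `M` along the two bijections `Sum.elim J J', Sum.elim I I' : Fin r ⊕ Fin k ≃ n`
(`N := M.submatrix (Sum.elim J J') (Sum.elim I I')`, so that `N⁻¹ = M⁻¹.submatrix (Sum.elim I I')
(Sum.elim J J')` has `₁₁` block `(M⁻¹)[I, J]` and `N` has `₂₂` block `M[J', I']`), and note that
reindexing rows and columns along two different bijections only changes the determinant by the
sign of a permutation (`Matrix.det_permute'`), invisible in norm.
-/

noncomputable section

namespace Summit.QuantumFields.QCD.Cruxes.PhaseQuenchedFlavourDecay.CrossingSplitIntegrability

/-- **Jacobi's complementary-minor theorem, block form.**  For a block matrix `N` over a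
commutative ring with `det N` a unit, the determinant of the `₁₁` block of `N⁻¹` times `det N` is
the determinant of the complementary (`₂₂`) block of `N`.  No invertibility of that block is
assumed. -/
theorem det_inv_toBlocks₁₁_mul_det {ι κ R : Type*} [Fintype ι] [DecidableEq ι] [Fintype κ]
    [DecidableEq κ] [CommRing R] (N : Matrix (ι ⊕ κ) (ι ⊕ κ) R) (hN : IsUnit N.det) :
    (N⁻¹.toBlocks₁₁).det * N.det = (N.toBlocks₂₂).det := by
  -- `N⁻¹ * N = 1`, read off blockwise
  have h1 : Matrix.fromBlocks N⁻¹.toBlocks₁₁ N⁻¹.toBlocks₁₂ N⁻¹.toBlocks₂₁ N⁻¹.toBlocks₂₂ *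
      Matrix.fromBlocks N.toBlocks₁₁ N.toBlocks₁₂ N.toBlocks₂₁ N.toBlocks₂₂ = 1 := by
    rw [Matrix.fromBlocks_toBlocks, Matrix.fromBlocks_toBlocks]
    exact Matrix.nonsing_inv_mul N hN
  rw [Matrix.fromBlocks_multiply, ← Matrix.fromBlocks_one, Matrix.fromBlocks_inj] at h1
  obtain ⟨h11, h12, -, -⟩ := h1
  -- the block-triangular factorisation `[[P, Q], [0, 1]] * N = [[1, 0], [C, D]]`
  have key : Matrix.fromBlocks N⁻¹.toBlocks₁₁ N⁻¹.toBlocks₁₂ 0 (1 : Matrix κ κ R) *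
      Matrix.fromBlocks N.toBlocks₁₁ N.toBlocks₁₂ N.toBlocks₂₁ N.toBlocks₂₂ =
      Matrix.fromBlocks 1 0 N.toBlocks₂₁ N.toBlocks₂₂ := by
    rw [Matrix.fromBlocks_multiply, h11, h12]
    simp
  have hdet := congrArg Matrix.det key
  rwa [Matrix.fromBlocks_toBlocks, Matrix.det_mul, Matrix.det_fromBlocks_zero₂₁,
    Matrix.det_fromBlocks_zero₁₂, Matrix.det_one, Matrix.det_one, mul_one, one_mul] at hdet

/-- Reindexing the rows and the columns of a complex square matrix along two (possibly different)
bijections does not change the norm of its determinant. -/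
theorem norm_det_submatrix_equiv_equiv {m n : Type*} [Fintype m] [DecidableEq m] [Fintype n]
    [DecidableEq n] (e₁ e₂ : n ≃ m) (A : Matrix m m ℂ) :
    ‖(A.submatrix e₁ e₂).det‖ = ‖A.det‖ := by
  have hee : A.submatrix e₁ e₂ = (A.submatrix id (e₁.symm.trans e₂)).submatrix e₁ e₁ := by
    ext i j
    simp
  rw [hee, Matrix.det_submatrix_equiv_self, Matrix.det_permute', norm_mul]
  rcases Int.units_eq_one_or (Equiv.Perm.sign (e₁.symm.trans e₂)) with h | h <;> simp [h]

/-- Two injective maps with disjoint ranges which jointly cover the target assemble into a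
bijection from the sum type. -/
theorem sumElim_bijective {α β γ : Type*} {f : α → γ} {g : β → γ} (hf : Function.Injective f)
    (hg : Function.Injective g) (hfg : ∀ a b, f a ≠ g b)
    (hcov : ∀ x, (∃ a, f a = x) ∨ (∃ b, g b = x)) : Function.Bijective (Sum.elim f g) := by
  refine ⟨hf.sumElim hg hfg, fun x => ?_⟩
  rcases hcov x with ⟨a, ha⟩ | ⟨b, hb⟩
  · exact ⟨Sum.inl a, ha⟩
  · exact ⟨Sum.inr b, hb⟩

/-- **Jacobi's complementary-minor theorem** for arbitrary minors, in norm form.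
If `I, J : Fin r → n` are injective enumerations of a set of rows and a set of columns, with
complements enumerated injectively by `I', J' : Fin k → n`, and `det M ≠ 0`, then
`‖det ((M⁻¹)[I, J])‖ * ‖det M‖ = ‖det (M[J', I'])‖`. -/
theorem stub_jacobiMinorNorm :
    ∀ (n : Type) [Fintype n] [DecidableEq n] (r k : ℕ) (M : Matrix n n ℂ) (I J : Fin r → n) (I' J' : Fin k → n),
      Function.Injective I → Function.Injective J → Function.Injective I' → Function.Injective J' →
      (∀ a b, I a ≠ I' b) → (∀ a b, J a ≠ J' b) → (∀ x, (∃ a, I a = x) ∨ (∃ b, I' b = x)) →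
      (∀ x, (∃ a, J a = x) ∨ (∃ b, J' b = x)) → M.det ≠ 0 →
      ‖((M⁻¹).submatrix I J).det‖ * ‖M.det‖ = ‖(M.submatrix J' I').det‖ := by
  intro n _ _ r k M I J I' J' hI hJ hI' hJ' hII' hJJ' hcovI hcovJ hM
  -- the two reindexing bijections `Fin r ⊕ Fin k ≃ n`
  obtain ⟨eI, heI⟩ : ∃ e : Fin r ⊕ Fin k ≃ n, ⇑e = Sum.elim I I' := by
    exact ⟨Equiv.ofBijective _ (sumElim_bijective hI hI' hII' hcovI), rfl⟩
  obtain ⟨eJ, heJ⟩ : ∃ e : Fin r ⊕ Fin k ≃ n, ⇑e = Sum.elim J J' := by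
    exact ⟨Equiv.ofBijective _ (sumElim_bijective hJ hJ' hJJ' hcovJ), rfl⟩
  -- the reindexed matrix `N := M.submatrix eJ eI` has `‖det N‖ = ‖det M‖ ≠ 0`
  have hNdet : ‖(M.submatrix eJ eI).det‖ = ‖M.det‖ := norm_det_submatrix_equiv_equiv eJ eI M
  have hNdet0 : (M.submatrix eJ eI).det ≠ 0 := fun h =>
    hM (by rwa [← norm_eq_zero, ← hNdet, norm_eq_zero])
  -- block Jacobi for `N`; its inverse is `M⁻¹.submatrix eI eJ`
  have hJac := det_inv_toBlocks₁₁_mul_det (M.submatrix eJ eI) (isUnit_iff_ne_zero.mpr hNdet0)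
  have hP : (M.submatrix eJ eI)⁻¹.toBlocks₁₁ = (M⁻¹).submatrix I J := by
    rw [Matrix.inv_submatrix_equiv]
    ext i j
    simp [Matrix.toBlocks₁₁, heI, heJ]
  have hD : (M.submatrix eJ eI).toBlocks₂₂ = M.submatrix J' I' := by
    ext i j
    simp [Matrix.toBlocks₂₂, heI, heJ]
  rw [hP, hD] at hJac
  rw [← hNdet, ← norm_mul, hJac]

end Summit.QuantumFields.QCD.Cruxes.PhaseQuenchedFlavourDecay.CrossingSplitIntegrability
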